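import Mathlib
import Summits.Ventures.PercRepro2.HCovTyped
import Summits.Ventures.PercRepro2.TypedSplit

/-!
# Row 2′TRI is (HCOV) under every product of exchangeable three-copy edge laws
(blind cell PercRepro2, night-3 g18, 2026-08-27; NIGHT3-CERT.md §27)

A three-copy coupling in which the edges are independent and, at each edge `e`, the law of the
three bits `(x e, y e, w e)` is EXCHANGEABLE is given by level weights `m e k ≥ 0` (the weight of
any one pattern with `k` open copies): the coupled weight of a triple is
`coupledWeight m x y w = ∏ e, m e (openCount x y w e)`, and the coupled expectation of a kernel is
`coupledSum m K = ∑ x y w, coupledWeight m x y w · K x y w`.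

* `coupledSum_eq_sum_typedCount` — the coupled expectation is the sum over the type maps
  `τ : E → Fin 4` of `(∏ e, m e (τ e))` times the typed count `typedCount univ z τ K` (the
  Bernstein-type expansion: the typed counts are the coefficients of the coupled expectation in
  the level weights);
* `typedCount_univ_eq_filter` — a type map with values in `{0, 1, 2, 3}` on all edges is the typed
  count of the minor whose typed edges are those of type `1, 2`, the others pinned to their type;
* **`coupledSum_nonneg_of_typedCount`** — if every typed count (types in `{1, 2}`) is nonnegative,
  so is the coupled expectation under every product of exchangeable edge laws; conversely
  (`typedCount_eq_coupledSum`) every typed count IS a coupled expectation (the level-`τ e` law at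
  `e`), hence **`typedBases_iff_coupledSum_nonneg`**: row 2′TRI for `K₃` ⟺ (HCOV)'s cubic form is
  nonnegative under EVERY product of exchangeable three-copy edge laws;
* `coupledSum_iid` — the i.i.d. law `m e k = p e ^ k (1 − p e) ^ (3 − k)` gives back the cubic
  form `∑ P(x) P(y) P(w) K(x, y, w)` (`triSum p ∅`), i.e. (HCOV) itself (`hcov_cubic`).

So the crux of record (row 2′TRI) is exactly the statement that (HCOV) is ROBUST under every
exchangeable per-edge coupling of its three copies — (HCOV) being the independent coupling — which
is why its proof cannot use the independence of the copies beyond what every such coupling shares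
(each copy is a product measure, also conditionally on the other two). Own work; standard axioms.
-/

namespace Summit.Ventures.PercRepro2

section Coupled

variable {E : Type*} [Fintype E] [DecidableEq E] {R : Type*} [CommRing R]

/-- The coupled weight of a triple under the product of exchangeable edge laws with level weights
`m`. -/
def coupledWeight (m : E → ℕ → R) (x y w : Config E) : R := ∏ e, m e (openCount x y w e)

/-- The coupled expectation of a three-copy kernel. -/
def coupledSum (m : E → ℕ → R) (K : Config E → Config E → Config E → R) : R :=
  ∑ x : Config E, ∑ y : Config E, ∑ w : Config E, coupledWeight m x y w * K x y w

omit [Fintype E] [DecidableEq E] in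
/-- Moving the innermost sum outermost (three swaps; `CovForm.sum_comm4` over a field). -/
lemma sum_swap4 {α β γ δ : Type*} [Fintype α] [Fintype β] [Fintype γ] [Fintype δ]
    (F : α → β → γ → δ → R) :
    (∑ x : α, ∑ y : β, ∑ z : γ, ∑ i : δ, F x y z i) = ∑ i : δ, ∑ x : α, ∑ y : β, ∑ z : γ, F x y z i := by
  have h1 : ∀ (x : α) (y : β), (∑ z : γ, ∑ i : δ, F x y z i) = ∑ i : δ, ∑ z : γ, F x y z i :=
    fun x y => Finset.sum_comm
  simp only [h1]
  have h2 : ∀ x : α, (∑ y : β, ∑ i : δ, ∑ z : γ, F x y z i) = ∑ i : δ, ∑ y : β, ∑ z : γ, F x y z i :=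
    fun x => Finset.sum_comm
  simp only [h2]
  exact Finset.sum_comm

/-- The open-count profile of a triple, as a map into `Fin 4`. -/
def ocFin (x y w : Config E) : E → Fin 4 := fun e => ⟨openCount x y w e, by
  have := openCount_le_three x y w e; omega⟩

/-- **The Bernstein-type expansion**: the coupled expectation is the sum over the type maps
`τ : E → Fin 4` of the level weights times the typed counts over the whole edge set. -/
theorem coupledSum_eq_sum_typedCount (m : E → ℕ → R) (z : Config E)
    (K : Config E → Config E → Config E → R) :
    coupledSum m K = ∑ τ : E → Fin 4, (∏ e, m e (τ e)) *
      typedCount Finset.univ z (fun e => ((τ e : Fin 4) : ℕ)) K := by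
  set G : Config E → Config E → Config E → (E → Fin 4) → R := fun x y w τ =>
    (∏ e, m e (τ e)) *
      (if (∀ e, e ∉ (Finset.univ : Finset E) → x e = z e ∧ y e = z e ∧ w e = z e) ∧
          (∀ e ∈ (Finset.univ : Finset E), openCount x y w e = ((τ e : Fin 4) : ℕ)) then
        K x y w else 0) with hG
  have hR : (∑ τ : E → Fin 4, (∏ e, m e (τ e)) *
      typedCount Finset.univ z (fun e => ((τ e : Fin 4) : ℕ)) K) =
      ∑ τ : E → Fin 4, ∑ x : Config E, ∑ y : Config E, ∑ w : Config E, G x y w τ := by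
    unfold typedCount
    simp only [hG, Finset.mul_sum]
  rw [hR, ← sum_swap4 G]
  unfold coupledSum
  refine Finset.sum_congr rfl fun x _ => Finset.sum_congr rfl fun y _ =>
    Finset.sum_congr rfl fun w _ => ?_
  rw [Finset.sum_eq_single (ocFin x y w)]
  · have hc : (∀ e, e ∉ (Finset.univ : Finset E) → x e = z e ∧ y e = z e ∧ w e = z e) ∧
        ∀ e ∈ (Finset.univ : Finset E), openCount x y w e = ((ocFin x y w e : Fin 4) : ℕ) := by
      refine ⟨fun e he => absurd (Finset.mem_univ e) he, fun e _ => rfl⟩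
    simp only [hG, if_pos hc]
    unfold coupledWeight
    rfl
  · intro τ _ hτ
    have hne : ¬ ((∀ e, e ∉ (Finset.univ : Finset E) → x e = z e ∧ y e = z e ∧ w e = z e) ∧
        ∀ e ∈ (Finset.univ : Finset E), openCount x y w e = ((τ e : Fin 4) : ℕ)) := by
      rintro ⟨_, h⟩
      apply hτ
      funext e
      exact Fin.ext ((h e (Finset.mem_univ e)).symm)
    simp only [hG, if_neg hne, mul_zero]
  · intro h
    exact absurd (Finset.mem_univ _) h

/-- **A type map on all edges with values `≤ 3` is a typed count of a minor**: the edges of type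
`1, 2` are the typed ones, the others pinned closed (type `0`) or open (type `3`). -/
theorem typedCount_univ_eq_filter (z : Config E) (τ : E → ℕ) (hτ : ∀ e, τ e ≤ 3)
    (K : Config E → Config E → Config E → R) :
    typedCount Finset.univ z τ K =
      typedCount (Finset.univ.filter fun e => τ e = 1 ∨ τ e = 2) (fun e => decide (τ e = 3)) τ K := by
  unfold typedCount
  refine Finset.sum_congr rfl fun x _ => Finset.sum_congr rfl fun y _ =>
    Finset.sum_congr rfl fun w _ => ?_
  refine if_congr ?_ rfl rfl
  constructor
  · rintro ⟨_, h⟩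
    refine ⟨fun e he => ?_, fun e he => h e (Finset.mem_univ e)⟩
    have he' : ¬ (τ e = 1 ∨ τ e = 2) := by
      intro h'; exact he (Finset.mem_filter.2 ⟨Finset.mem_univ e, h'⟩)
    have hoc := h e (Finset.mem_univ e)
    have hle := hτ e
    rcases Nat.lt_or_ge (τ e) 1 with h0 | h1
    · have h0' : τ e = 0 := by omega
      rw [h0'] at hoc
      obtain ⟨hx, hy, hw⟩ := (openCount_eq_zero_iff x y w e).1 hoc
      simp only [h0', hx, hy, hw, decide_eq_false (by omega : ¬ (0 : ℕ) = 3), and_self]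
    · have h3 : τ e = 3 := by omega
      rw [h3] at hoc
      obtain ⟨hx, hy, hw⟩ := (openCount_eq_three_iff x y w e).1 hoc
      simp only [h3, hx, hy, hw, decide_true, and_self]
  · rintro ⟨h1, h2⟩
    refine ⟨fun e he => absurd (Finset.mem_univ e) he, fun e _ => ?_⟩
    by_cases hmem : τ e = 1 ∨ τ e = 2
    · exact h2 e (Finset.mem_filter.2 ⟨Finset.mem_univ e, hmem⟩)
    · have he : e ∉ Finset.univ.filter fun e => τ e = 1 ∨ τ e = 2 := fun h =>
        hmem (Finset.mem_filter.1 h).2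
      obtain ⟨hx, hy, hw⟩ := h1 e he
      have hle := hτ e
      rcases Nat.lt_or_ge (τ e) 1 with h0 | h1'
      · have h0' : τ e = 0 := by omega
        simp only [h0', decide_eq_false (by omega : ¬ (0 : ℕ) = 3)] at hx hy hw
        rw [h0']
        exact (openCount_eq_zero_iff x y w e).2 ⟨hx, hy, hw⟩
      · have h3 : τ e = 3 := by omega
        simp only [h3, decide_true] at hx hy hw
        rw [h3]
        exact (openCount_eq_three_iff x y w e).2 ⟨hx, hy, hw⟩

end Coupled

section Nonneg

variable {E : Type*} [Fintype E] [DecidableEq E] {R : Type*} [CommRing R] [LinearOrder R]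
  [IsStrictOrderedRing R]

/-- **Nonnegative typed counts give a nonnegative coupled expectation** under every product of
exchangeable edge laws. -/
theorem coupledSum_nonneg_of_typedCount (K : Config E → Config E → Config E → R)
    (hcount : ∀ (F : Finset E) (z : Config E) (τ : E → ℕ), (∀ e ∈ F, τ e = 1 ∨ τ e = 2) →
      0 ≤ typedCount F z τ K)
    (m : E → ℕ → R) (hm : ∀ e k, 0 ≤ m e k) : 0 ≤ coupledSum m K := by
  rw [coupledSum_eq_sum_typedCount m (fun _ => false) K]
  refine Finset.sum_nonneg fun τ _ => ?_
  refine mul_nonneg (Finset.prod_nonneg fun e _ => hm e _) ?_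
  have hle : ∀ e, ((τ e : Fin 4) : ℕ) ≤ 3 := fun e => Nat.lt_succ_iff.1 (τ e).isLt
  rw [typedCount_univ_eq_filter (fun _ => false) _ hle K]
  exact hcount _ _ _ fun e he => (Finset.mem_filter.1 he).2

omit [LinearOrder R] [IsStrictOrderedRing R] in
/-- **Every typed count is a coupled expectation**: the level-`τ e` law at each edge. -/
theorem typedCount_eq_coupledSum (z : Config E) (τ : E → ℕ)
    (K : Config E → Config E → Config E → R) :
    typedCount Finset.univ z τ K = coupledSum (fun e k => if k = τ e then 1 else 0) K := by
  unfold typedCount coupledSum coupledWeight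
  refine Finset.sum_congr rfl fun x _ => Finset.sum_congr rfl fun y _ =>
    Finset.sum_congr rfl fun w _ => ?_
  by_cases h : ∀ e, openCount x y w e = τ e
  · rw [if_pos ⟨fun e he => absurd (Finset.mem_univ e) he, fun e _ => h e⟩]
    rw [Finset.prod_eq_one fun e _ => if_pos (h e), one_mul]
  · rw [if_neg fun h' => h fun e => h'.2 e (Finset.mem_univ e)]
    rw [not_forall] at h
    obtain ⟨e, he⟩ := h
    rw [Finset.prod_eq_zero (Finset.mem_univ e) (if_neg he), zero_mul]

omit [LinearOrder R] [IsStrictOrderedRing R] in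
/-- A typed count over a minor `(F, z)` with types in `{1, 2}` is a typed count over all edges
(the pinned edges given their pinned type). -/
theorem typedCount_eq_univ (F : Finset E) (z : Config E) (τ : E → ℕ)
    (hτ : ∀ e ∈ F, τ e = 1 ∨ τ e = 2) (K : Config E → Config E → Config E → R) :
    typedCount F z τ K =
      typedCount Finset.univ z (fun e => if e ∈ F then τ e else if z e then 3 else 0) K := by
  set τ' : E → ℕ := fun e => if e ∈ F then τ e else if z e then 3 else 0 with hτ'
  have hle : ∀ e, τ' e ≤ 3 := by
    intro e
    by_cases h1 : e ∈ F
    · have : τ' e = τ e := by simp only [hτ', h1, if_true]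
      rw [this]
      rcases hτ e h1 with h | h <;> omega
    · have : τ' e = if z e then 3 else 0 := by simp only [hτ', h1, if_false]
      rw [this]
      split_ifs <;> omega
  rw [typedCount_univ_eq_filter z τ' hle K]
  have hF : (Finset.univ.filter fun e => τ' e = 1 ∨ τ' e = 2) = F := by
    ext e
    simp only [Finset.mem_filter, Finset.mem_univ, true_and, hτ']
    constructor
    · intro h
      by_contra he
      simp only [he, if_false] at h
      rcases h with h | h <;> split_ifs at h <;> omega
    · intro he
      simp only [he, if_true]
      exact hτ e he
  rw [hF]
  rw [CovForm.TypedRed.typedCount_congr_z F (z := fun e => decide (τ' e = 3)) (z' := z)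
    (fun e he => ?_) τ' K]
  · exact CovForm.TypedRed.typedCount_congr_τ F _ (fun e he => by simp only [hτ', he, if_true]) K
  · simp only [hτ', he, if_false]
    cases z e <;> simp

end Nonneg

section Iff

variable {V : Type*} {E : Type*} [Fintype E] [DecidableEq E] {R : Type*} [Field R] [LinearOrder R]
  [IsStrictOrderedRing R]

/-- **Row 2′TRI ⟺ (HCOV) under every product of exchangeable three-copy edge laws.** -/
theorem typedBases_iff_coupledSum_nonneg (ends : E → Sym2 V) (o a₁ a₂ a₃ b : V) :
    CovForm.TypedBases (R := R) ends o a₁ a₂ a₃ b ↔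
      ∀ m : E → ℕ → R, (∀ e k, 0 ≤ m e k) →
        0 ≤ coupledSum m (CovForm.K3 ends o a₁ a₂ a₃ b : Config E → Config E → Config E → R) := by
  constructor
  · intro h m hm
    exact coupledSum_nonneg_of_typedCount _ h m hm
  · intro h F z τ hτ
    rw [typedCount_eq_univ F z τ hτ, typedCount_eq_coupledSum]
    exact h _ fun e k => by split_ifs <;> norm_num

end Iff

section IID

variable {E : Type*} [Fintype E] [DecidableEq E] {R : Type*} [CommRing R]

/-- **The independent coupling**: the level weights `p e ^ k (1 − p e) ^ (3 − k)` give the cubic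
form `∑ P(x) P(y) P(w) K(x, y, w)` — (HCOV)'s `triSum p ∅ τ K` (`hcov_cubic`). -/
theorem coupledSum_iid (p : E → R) (τ : E → ℕ) (K : Config E → Config E → Config E → R) :
    coupledSum (fun e k => p e ^ k * (1 - p e) ^ (3 - k)) K = triSum p ∅ τ K := by
  rw [triSum_empty]
  unfold coupledSum coupledWeight
  refine Finset.sum_congr rfl fun x _ => Finset.sum_congr rfl fun y _ =>
    Finset.sum_congr rfl fun w _ => ?_
  congr 1
  unfold weight
  rw [← Finset.prod_mul_distrib, ← Finset.prod_mul_distrib]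
  refine Finset.prod_congr rfl fun e _ => ?_
  rw [edgeFactor_three]
  rfl

end IID

end Summit.Ventures.PercRepro2
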